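import Summits.Ventures.CertifiedArithmetic.LowPrec.GemmThetaLawE2M1Defs

/-!
# The all-precision θ-certificate of E2M1²: kernel check of the low classes of binades 0–3

HONEST FRAMING (venture CertifiedArithmetic / cell `pub-lowprec`, seat gemm, gen 12): certified error
envelopes and provably optimal rounding/accumulation schemes for low-precision formats under stated
cost models; every table by two implementations; no hardware or vendor claims.

Part 2 of 7 of the kernel check of the symbolic certificate `GemmThetaLawE2M1Defs.lean` (paper
`gemm.tex` §Regimes Thm t:thetap (iii), configuration E2M1·E2M1 → any `p`-bit accumulator, `p ≥ 9`,
sequential, RNE): by `decide +kernel`, one theorem per block of classes (a block of 72 classes is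
5,328 symbolic edge evaluations).  Split into files only to bound each file's kernel time;
`GemmThetaLawE2M1Checks.lean` assembles the parts.  See the Defs file for the meaning of the checks
and `GemmThetaLawE2M1Edge.lean` / `…Law.lean` for their soundness at every precision.
-/

namespace Literature.ComputerArithmetic.FloatingPoint

namespace MiniFloat

namespace ThetaLawE2M1

/-- Every edge from the classes `low 0 t`, `t ≤ 71` (both signs, all 37 letters) passes `edgeOK`.
[cell certificate, kernel-checked] -/
theorem low_ok_0 : lowOK 0 0 72 = true := by
  decide +kernel

/-- Every edge from the classes `low 1 t`, `t ≤ 71` (both signs, all 37 letters) passes `edgeOK`.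
[cell certificate, kernel-checked] -/
theorem low_ok_1 : lowOK 1 0 72 = true := by
  decide +kernel

/-- Every edge from the classes `low 2 t`, `t ≤ 71` (both signs, all 37 letters) passes `edgeOK`.
[cell certificate, kernel-checked] -/
theorem low_ok_2 : lowOK 2 0 72 = true := by
  decide +kernel

/-- Every edge from the classes `low 3 t`, `t ≤ 71` (both signs, all 37 letters) passes `edgeOK`.
[cell certificate, kernel-checked] -/
theorem low_ok_3 : lowOK 3 0 72 = true := by
  decide +kernel

end ThetaLawE2M1

end MiniFloat

end Literature.ComputerArithmetic.FloatingPoint
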